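import Literature.Analysis.FluidPDE.TorusNS2DGlobalBounds
import Literature.Analysis.FluidPDE.TorusClassicalNSForcedRestart
import Literature.Analysis.FluidPDE.TorusWordSpaceTime
import Literature.Analysis.FunctionSpaces.TorusClassicalNSPerturbedRestart
import Literature.Analysis.FunctionSpaces.TorusScalarFourierSeries
import Mathlib.MeasureTheory.Integral.MeanInequalities
import HarnessLib

/-!
# Global classical solutions of the forced Navier–Stokes equations on the two-torus
# (Ladyzhenskaya 1959)

Analysis/FluidPDE proof file (theorems only; no definitions, no named facts).  **Theorem**
(`Torus.exists_classicalNS_forced_fin_two`).  Let `ν > 0`, `a < b`, let `ū` be jointly smooth on a time set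
`S ⊇ [a, b]` with divergence-free slices on `[a, b]`, let the force be `f = ∂ₜū` on `[a, b]` (the one-sided
time derivative within `S`; every smooth divergence-free force is of this form), and let `u₀ : 𝕋² → ℝ²` be
smooth and divergence free.  Then the system `∂ₜu + (u·∇)u = νΔu − ∇p + f`, `div u = 0` has a CLASSICAL
solution `(u, p)` on the whole window `[a, b] × 𝕋²` with `u(a) = u₀` — two-dimensional flows do not blow up
(Ladyzhenskaya 1959, Thm. 1 & 3; Foias–Manley–Rosa–Temam 2001, Ch. II Thm. 7.4; Kuksin–Shirikyan 2012,
Thm. 2.1.18–19 with Cor. 2.1.20; Temam 1995, Part I Thm. 3.2; Majda–Bertozzi 2002, §3.3 Cor. 3.3).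

Proof (the continuation argument, Majda–Bertozzi 2002, Thm. 3.4 ⇒ Cor. 3.3; Robinson–Rodrigo–Sadowski 2016,
§8.1): (1) the a priori bounds of `TorusNS2DGlobalBounds` bound `E_0, …, E_6` of every classical solution
through `u₀` on every window `[a, c] ⊆ [a, b]` by one constant; (2) `E_0, E_m ≤ B` give the Fourier decay
`‖𝓕(uⱼ)(k)‖ ≤ 2^{m+1} B^{1/2} (1 + ‖k‖)^{-m}` (`Torus.hasDecay_mFourierCoeff_apply_of_wordEnergy_le`,
`𝓕(∂ᵢ^m g)(k) = (2πi kᵢ)^m 𝓕g(k)`), so every slice is a datum of one fixed level `M` for the restart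
theorem `Torus.exists_classicalNS_forced_restart` (order `2·#d + 2 = 6` on `𝕋²`), whose life span `θ`
depends on the level only; (3) restart at `s = max(a, c − θ/2)`, identify on the overlap and glue
(`IsClassicalNSSolutionOn.glue_restart`), gaining `θ/2` each time until `b` is reached.

WHAT THIS IS NOT: nothing in dimension three; no statement about weak solutions.

## Tree / Mathlib search

Reused: `Torus.exists_wordEnergy_le_fin_two` (`TorusNS2DGlobalBounds`), `Torus.exists_classicalNS_forced_restart`
(`TorusClassicalNSForcedRestart`), `IsClassicalNSSolutionOn.glue_restart`, `….mono`,
`IsSmoothSpaceTimeOn.timeDerivWithin(_eq_of_subset)`, `isSmoothSpaceTimeOn_wordDeriv`,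
`IsSmoothSpaceTimeOn.exists_norm_le_of_isCompact`, `mFourierCoeff_partialDeriv_iterate`,
`mFourierCoeff_eq_integral_volume`, `wordDeriv_replicate`, `wordDeriv_clm_comp`,
`integral_norm_sq_wordDeriv_le_wordEnergy`; Mathlib `integral_mul_le_Lp_mul_Lq_of_nonneg`,
`pi_norm_le_iff_of_nonneg`, `Finset.exists_max_image`, `exists_nat_ge`.
`lean search 'classicalNS.*fin_two|global.*fin_two|exists_classicalNS_forced_global'`: no hits.

## References

* O. A. Ladyzhenskaya, CPAM 12 (1959) 427–433, Thm. 1, Thm. 3. [Ladyzhenskaya1959]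
* C. Foias, O. Manley, R. Rosa, R. Temam, *Navier–Stokes Equations and Turbulence*, CUP 2001, Ch. II Thm. 7.4,
  App. II.A (A.62)–(A.67). [FoiasManleyRosaTemam2001]
* S. Kuksin, A. Shirikyan, *Mathematics of Two-Dimensional Turbulence*, CUP 2012, Thm. 2.1.18–2.1.19,
  Cor. 2.1.20. [KuksinShirikyan2012]
* A. J. Majda, A. L. Bertozzi, *Vorticity and Incompressible Flow*, CUP 2002, Thm. 3.4, §3.3 Cor. 3.3. [MajdaBertozziCUP2002]
* L. Grafakos, *Classical Fourier Analysis*, 3rd ed., Springer 2014, Prop. 3.2.7 / Thm. 3.3.9 (`𝓕(∂^α f)(k) = (2πik)^α 𝓕f(k)`,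
  decay of coefficients of smooth functions). [Grafakos2014]
-/

noncomputable section

open MeasureTheory Set Function Filter UnitAddTorus
open scoped ContDiff InnerProductSpace Topology

namespace Literature.Analysis.FluidPDE

namespace Torus

open FunctionSpaces FunctionSpaces.Torus
open FourierNS (HasDecay)
open ScalarFourier (latOrder)

variable {d : Type*} [Fintype d] [DecidableEq d]

/-! ## §1 Fourier decay of a field from two of its word energies -/

section Decay

omit [DecidableEq d] in
/-- `∫ Ψ ≤ (∫ Ψ²)^{1/2}` on the probability space `𝕋^d` for `Ψ ≥ 0` in `L²` (Hölder against `1`). [folklore] -/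
private theorem integral_le_sqrt_integral_sq' {Ψ : UnitAddTorus d → ℝ} (hΨ : MemLp Ψ 2 volume)
    (hΨ0 : ∀ x, 0 ≤ Ψ x) : ∫ x, Ψ x ≤ Real.sqrt (∫ x, Ψ x ^ 2) := by
  have h := integral_mul_le_Lp_mul_Lq_of_nonneg Real.HolderConjugate.two_two
    (f := Ψ) (g := fun _ => (1 : ℝ))
    (Eventually.of_forall hΨ0) (Eventually.of_forall fun x => zero_le_one)
    (by rw [ENNReal.ofReal_ofNat]; exact hΨ) (by rw [ENNReal.ofReal_ofNat]; exact memLp_const _)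
  simp only [mul_one, Real.rpow_two, one_pow, integral_const, smul_eq_mul] at h
  rw [← Real.sqrt_eq_rpow] at h
  simpa using h

omit [DecidableEq d] in
/-- A single Fourier coefficient is bounded by the `L²` norm: `‖𝓕h(k)‖ ≤ (∫ ‖h‖²)^{1/2}` for smooth
`h : 𝕋^d → ℂ` (`|e_{-k}| = 1`, then `L¹ ≤ L²` on a probability space). [folklore] -/
private theorem norm_mFourierCoeff_le_sqrt {h : UnitAddTorus d → ℂ} (hh : IsSmooth h) (k : d → ℤ) :
    ‖mFourierCoeff h k‖ ≤ Real.sqrt (∫ x, ‖h x‖ ^ 2) := by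
  have h1 : ‖mFourierCoeff h k‖ ≤ ∫ x, ‖h x‖ := by
    rw [mFourierCoeff_eq_integral_volume]
    refine (norm_integral_le_integral_norm _).trans ?_
    refine integral_mono_of_nonneg (ae_of_all _ fun x => norm_nonneg _) hh.continuous.norm.integrable_unitAddTorus
      (ae_of_all _ fun x => ?_)
    show ‖mFourier (-k) x • h x‖ ≤ ‖h x‖
    rw [norm_smul]
    exact mul_le_of_le_one_left (norm_nonneg _) (((mFourier (-k)).norm_coe_le_norm x).trans_eq mFourier_norm)
  refine h1.trans (integral_le_sqrt_integral_sq' ?_ fun x => norm_nonneg _)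
  exact (hh.continuous.norm).memLp_of_hasCompactSupport (HasCompactSupport.of_compactSpace _)

omit [Fintype d] [DecidableEq d] in
/-- `(1 + x)^m ≤ 2^m (1 + x^m)` for `x ≥ 0`. [folklore] -/
private theorem one_add_pow_le_two_pow_mul {x : ℝ} (hx : 0 ≤ x) (m : ℕ) : (1 + x) ^ m ≤ 2 ^ m * (1 + x ^ m) := by
  have hxm : 0 ≤ x ^ m := pow_nonneg hx m
  rcases le_total x 1 with h | h
  · calc (1 + x) ^ m ≤ 2 ^ m := pow_le_pow_left₀ (by positivity) (by linarith) m
      _ ≤ 2 ^ m * (1 + x ^ m) := le_mul_of_one_le_right (by positivity) (by linarith)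
  · calc (1 + x) ^ m ≤ (2 * x) ^ m := pow_le_pow_left₀ (by positivity) (by linarith) m
      _ = 2 ^ m * x ^ m := mul_pow 2 x m
      _ ≤ 2 ^ m * (1 + x ^ m) := mul_le_mul_of_nonneg_left (by linarith) (by positivity)

/-- **Fourier decay of a smooth field from two word energies** (`𝓕(∂ᵢ^m g)(k) = (2πi kᵢ)^m 𝓕g(k)`,
Grafakos 2014, Prop. 3.2.7 / Thm. 3.3.9, with `‖𝓕h(k)‖ ≤ ‖h‖₂` and `‖k‖_∞ = |kᵢ|` for a maximal coordinate
`i`): if `E_0(v) ≤ B` and `E_m(v) ≤ B` then every component of `v : 𝕋^d → ℝ^d` satisfies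
`‖𝓕(vⱼ)(k)‖ ≤ 2^{m+1} B^{1/2} (1 + ‖k‖)^{-m}`, i.e. `HasDecay m (2^{m+1} √B) (𝓕 vⱼ)`. [cite: Grafakos2014, Thm. 3.3.9] -/
theorem hasDecay_mFourierCoeff_apply_of_wordEnergy_le {v : UnitAddTorus d → EuclideanSpace ℝ d}
    (hv : IsSmooth v) (m : ℕ) {B : ℝ} (h0 : wordEnergy 0 v ≤ B) (hm : wordEnergy m v ≤ B) (j : d) :
    HasDecay m (2 ^ (m + 1) * Real.sqrt B) (fun k => mFourierCoeff (fun x => ((v x j : ℝ) : ℂ)) k) := by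
  intro k
  dsimp only
  -- the component as a continuous linear image of the field
  obtain ⟨L, hL⟩ : ∃ L : EuclideanSpace ℝ d →L[ℝ] ℂ, ∀ y, L y = ((y j : ℝ) : ℂ) :=
    ⟨Complex.ofRealCLM.comp (EuclideanSpace.proj j), fun y => by simp⟩
  have hgL : (fun x => ((v x j : ℝ) : ℂ)) = L ∘ v := funext fun x => (hL (v x)).symm
  have hgs : IsSmooth (fun x => ((v x j : ℝ) : ℂ)) := by rw [hgL]; exact hv.comp_clm L
  -- `(2π|kᵢ|)^n ‖𝓕g(k)‖ ≤ √E_n(v)` along the pure word `i…i`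
  have hcoef : ∀ (i : d) (n : ℕ), wordEnergy n v ≤ B →
      (2 * Real.pi * |(k i : ℝ)|) ^ n * ‖mFourierCoeff (fun x => ((v x j : ℝ) : ℂ)) k‖ ≤ Real.sqrt B := by
    intro i n hn
    have e1 := mFourierCoeff_partialDeriv_iterate hgs i n k
    have hnorm : ‖(2 * Real.pi * Complex.I * (k i : ℂ)) ^ n‖ = (2 * Real.pi * |(k i : ℝ)|) ^ n := by
      rw [norm_pow, norm_mul, norm_mul, norm_mul, Complex.norm_I, mul_one, Complex.norm_intCast, Complex.norm_real,
        Real.norm_eq_abs, Complex.norm_ofNat, abs_of_pos Real.pi_pos]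
    have hgi : IsSmooth ((Torus.partialDeriv i)^[n] (fun x => ((v x j : ℝ) : ℂ))) := isSmooth_partialDeriv_iterate hgs i n
    have h2 := norm_mFourierCoeff_le_sqrt hgi k
    have e2 : (Torus.partialDeriv i)^[n] (fun x => ((v x j : ℝ) : ℂ)) = L ∘ wordDeriv (List.replicate n i) v := by
      rw [← wordDeriv_replicate, hgL, wordDeriv_clm_comp hv L]
    have h3 : ∫ x, ‖((Torus.partialDeriv i)^[n] (fun x => ((v x j : ℝ) : ℂ))) x‖ ^ 2 ≤ wordEnergy n v := by
      have hle : ∀ x, ‖((Torus.partialDeriv i)^[n] (fun x => ((v x j : ℝ) : ℂ))) x‖ ^ 2 ≤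
          ‖wordDeriv (List.replicate n i) v x‖ ^ 2 := by
        intro x
        rw [e2, Function.comp_apply, hL, Complex.norm_real, Real.norm_eq_abs]
        exact pow_le_pow_left₀ (abs_nonneg _) (FourierNS.abs_apply_le_norm _ j) 2
      calc ∫ x, ‖((Torus.partialDeriv i)^[n] (fun x => ((v x j : ℝ) : ℂ))) x‖ ^ 2
          ≤ ∫ x, ‖wordDeriv (List.replicate n i) v x‖ ^ 2 :=
            integral_mono (hgi.continuous.norm.pow 2).integrable_unitAddTorus
              ((isSmooth_wordDeriv hv _).continuous.norm.pow 2).integrable_unitAddTorus hle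
        _ ≤ wordEnergy n v := by
            have h := integral_norm_sq_wordDeriv_le_wordEnergy (fun _ : Fin n => i) v
            rwa [List.ofFn_const] at h
    calc (2 * Real.pi * |(k i : ℝ)|) ^ n * ‖mFourierCoeff (fun x => ((v x j : ℝ) : ℂ)) k‖
        = ‖mFourierCoeff ((Torus.partialDeriv i)^[n] (fun x => ((v x j : ℝ) : ℂ))) k‖ := by
          rw [e1, norm_smul, hnorm]
      _ ≤ _ := h2
      _ ≤ Real.sqrt (wordEnergy n v) := Real.sqrt_le_sqrt h3
      _ ≤ Real.sqrt B := Real.sqrt_le_sqrt hn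
  -- a maximal coordinate realises the sup norm of `k`
  obtain ⟨i, -, hi⟩ := Finset.exists_max_image Finset.univ (fun b : d => |(k b : ℝ)|) ⟨j, Finset.mem_univ j⟩
  have hki : ‖k‖ ≤ |(k i : ℝ)| := (pi_norm_le_iff_of_nonneg (abs_nonneg _)).2 fun b => by
    rw [Int.norm_eq_abs]; exact hi b (Finset.mem_univ b)
  have hk0 : 0 ≤ ‖k‖ := norm_nonneg _
  have hpi : ‖k‖ ≤ 2 * Real.pi * |(k i : ℝ)| := by
    have : |(k i : ℝ)| ≤ 2 * Real.pi * |(k i : ℝ)| := by nlinarith [Real.pi_gt_three, abs_nonneg ((k i : ℝ))]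
    exact hki.trans this
  have hm' : ‖k‖ ^ m * ‖mFourierCoeff (fun x => ((v x j : ℝ) : ℂ)) k‖ ≤ Real.sqrt B :=
    (mul_le_mul_of_nonneg_right (pow_le_pow_left₀ hk0 hpi m) (norm_nonneg _)).trans (hcoef i m hm)
  have h0' : ‖mFourierCoeff (fun x => ((v x j : ℝ) : ℂ)) k‖ ≤ Real.sqrt B := by
    have h := hcoef i 0 h0
    rwa [pow_zero, one_mul] at h
  have hpow := one_add_pow_le_two_pow_mul hk0 m
  have hpos : 0 < (1 + ‖k‖) ^ m := by positivity
  rw [← div_eq_mul_inv, le_div_iff₀ hpos]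
  calc ‖mFourierCoeff (fun x => ((v x j : ℝ) : ℂ)) k‖ * (1 + ‖k‖) ^ m
      ≤ ‖mFourierCoeff (fun x => ((v x j : ℝ) : ℂ)) k‖ * (2 ^ m * (1 + ‖k‖ ^ m)) :=
        mul_le_mul_of_nonneg_left hpow (norm_nonneg _)
    _ = 2 ^ m * (‖mFourierCoeff (fun x => ((v x j : ℝ) : ℂ)) k‖ +
          ‖k‖ ^ m * ‖mFourierCoeff (fun x => ((v x j : ℝ) : ℂ)) k‖) := by ring
    _ ≤ 2 ^ m * (Real.sqrt B + Real.sqrt B) := mul_le_mul_of_nonneg_left (add_le_add h0' hm') (by positivity)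
    _ = 2 ^ (m + 1) * Real.sqrt B := by ring

end Decay

/-! ## §2 Word energies of the slices of a jointly smooth field on a compact time set -/

section ForceLevel

variable {F' : Type*} [NormedAddCommGroup F'] [InnerProductSpace ℝ F']

/-- **The word energies of a jointly smooth field are bounded on compact time sets**: for `F` jointly
smooth on `S` (a time set of unique differentiability), `K ⊆ S` compact and `N`, there is `Φ ≥ 0` with
`E_n(F(t)) ≤ Φ` for all `n ≤ N`, `t ∈ K` (each `∂^w F` is jointly continuous on the compact `K × 𝕋^d`;
finitely many words). [folklore] (bookkeeping) [cite: MajdaBertozziCUP2002, §3.2] -/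
theorem exists_wordEnergy_slice_le {S K : Set ℝ} {F : ℝ → UnitAddTorus d → F'} (hF : Torus.IsSmoothSpaceTimeOn S F)
    (hS : UniqueDiffOn ℝ S) (hK : IsCompact K) (hKS : K ⊆ S) (N : ℕ) :
    ∃ Φ : ℝ, 0 ≤ Φ ∧ ∀ n, n ≤ N → ∀ t ∈ K, wordEnergy n (F t) ≤ Φ := by
  classical
  -- a sup bound for every word derivative on `K × 𝕋^d`
  have hw : ∀ w : List d, ∃ C : ℝ, ∀ t ∈ K, ∀ x, ‖wordDeriv w (F t) x‖ ≤ C := fun w =>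
    (isSmoothSpaceTimeOn_wordDeriv hF hS w).exists_norm_le_of_isCompact hK hKS
  choose C hC using hw
  -- the energy of order `n` at time `t ∈ K` is at most `∑_{|w| = n} C_w²`
  have hEn : ∀ n, ∀ t ∈ K, wordEnergy n (F t) ≤ ∑ w : Fin n → d, C (List.ofFn w) ^ 2 := by
    intro n t ht
    unfold wordEnergy
    refine Finset.sum_le_sum fun w _ => ?_
    have hsm : IsSmooth (wordDeriv (List.ofFn w) (F t)) := isSmooth_wordDeriv (hF.isSmooth_slice (hKS ht)) _
    calc ∫ x, ‖wordDeriv (List.ofFn w) (F t) x‖ ^ 2 ≤ ∫ _ : UnitAddTorus d, C (List.ofFn w) ^ 2 := by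
          refine integral_mono (hsm.continuous.norm.pow 2).integrable_unitAddTorus (integrable_const _) fun x => ?_
          exact pow_le_pow_left₀ (norm_nonneg _) (hC _ t ht x) 2
      _ = C (List.ofFn w) ^ 2 := by
          rw [integral_const, smul_eq_mul, Measure.real, measure_univ, ENNReal.toReal_one, one_mul]
  refine ⟨∑ n ∈ Finset.range (N + 1), ∑ w : Fin n → d, C (List.ofFn w) ^ 2,
    Finset.sum_nonneg fun n _ => Finset.sum_nonneg fun w _ => sq_nonneg _, fun n hn t ht => ?_⟩
  exact (hEn n t ht).trans (Finset.single_le_sum (f := fun n => ∑ w : Fin n → d, C (List.ofFn w) ^ 2)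
    (fun n _ => Finset.sum_nonneg fun w _ => sq_nonneg _) (Finset.mem_range.2 (Nat.lt_succ_of_le hn)))

end ForceLevel

/-! ## §3 Global classical solutions on the two-torus -/

section Global

/-- **Global classical solutions of the forced Navier–Stokes equations on `𝕋²`** (Ladyzhenskaya 1959,
Thm. 1 & 3; FMRT 2001, Ch. II Thm. 7.4; Kuksin–Shirikyan 2012, Thm. 2.1.18–19 & Cor. 2.1.20; Majda–Bertozzi 2002,
§3.3 Cor. 3.3).  Let `ν > 0`, `a < b`, `ū` jointly smooth on a time set `S ⊇ [a, b]` with divergence-free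
slices on `[a, b]`, `f = ∂ₜū` on `[a, b]` (one-sided time derivative within `S`), and `u₀ : 𝕋² → ℝ²` smooth and
divergence free.  Then there is a classical solution `(u, p)` of `∂ₜu + (u·∇)u = νΔu − ∇p + f`, `div u = 0` on
`[a, b] × 𝕋²` with `u(a) = u₀`.  (Continuation with the uniform restart theorem at the decay level supplied by the
two-dimensional a priori bounds; see the module docstring.) [cite: Ladyzhenskaya1959, Thm. 1] -/
theorem exists_classicalNS_forced_fin_two {ν a b : ℝ} (hν : 0 < ν) (hab : a < b) {S : Set ℝ}
    (hS : Icc a b ⊆ S) {ū f : ℝ → UnitAddTorus (Fin 2) → EuclideanSpace ℝ (Fin 2)}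
    (hū : Torus.IsSmoothSpaceTimeOn S ū) (hūdiv : ∀ t ∈ Icc a b, IsDivFree (ū t))
    (hf : ∀ t ∈ Icc a b, ∀ x, Torus.timeDerivWithin S ū t x = f t x)
    {u₀ : UnitAddTorus (Fin 2) → EuclideanSpace ℝ (Fin 2)} (hu₀ : IsSmooth u₀) (hu₀div : IsDivFree u₀) :
    ∃ (u : ℝ → UnitAddTorus (Fin 2) → EuclideanSpace ℝ (Fin 2)) (p : ℝ → UnitAddTorus (Fin 2) → ℝ),
      Torus.IsClassicalNSSolutionOn (Icc a b) ν f u p ∧ u a = u₀ := by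
  have hU : UniqueDiffOn ℝ (Icc a b) := uniqueDiffOn_Icc hab
  have hū' : Torus.IsSmoothSpaceTimeOn (Icc a b) ū := hū.mono hS
  have hf' : ∀ t ∈ Icc a b, ∀ x, Torus.timeDerivWithin (Icc a b) ū t x = f t x := fun t ht x => by
    rw [hū.timeDerivWithin_eq_of_subset hS hU ht x]
    exact hf t ht x
  -- (0) the force is jointly smooth on `[a, b]`; its word energies up to order `6` are bounded there
  have hF : Torus.IsSmoothSpaceTimeOn (Icc a b) (Torus.timeDerivWithin (Icc a b) ū) := hū'.timeDerivWithin hU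
  obtain ⟨Φ, hΦ0, hΦ⟩ := exists_wordEnergy_slice_le hF hU isCompact_Icc subset_rfl 6
  have hΦf : ∀ n, n ≤ 6 → ∀ t ∈ Icc a b, wordEnergy n (f t) ≤ Φ := by
    intro n hn t ht
    have e : f t = Torus.timeDerivWithin (Icc a b) ū t := by
      funext x; exact (hf' t ht x).symm
    rw [e]
    exact hΦ n hn t ht
  -- (1) the datum level and the a priori bound on windows of length `≤ b - a`
  set D : ℝ := ∑ n ∈ Finset.range 7, wordEnergy n u₀ with hD
  have hD0 : 0 ≤ D := Finset.sum_nonneg fun n _ => wordEnergy_nonneg _ _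
  have hDn : ∀ n, n ≤ 6 → wordEnergy n u₀ ≤ D := fun n hn =>
    Finset.single_le_sum (f := fun n => wordEnergy n u₀) (fun i _ => wordEnergy_nonneg _ _)
      (Finset.mem_range.2 (by omega))
  obtain ⟨B, hB0, hB⟩ := exists_wordEnergy_le_fin_two 6 (τ := b - a) hν hD0 hΦ0
  -- (2) one decay level for the datum and for every slice of every solution through `u₀`
  set Lv : ℝ := max B D with hLv
  set M : ℝ := 2 ^ (6 + 1) * Real.sqrt Lv with hM
  have hlat : latOrder (Fin 2) + 2 = 6 := by
    simp [latOrder]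
  have hdec : ∀ v : UnitAddTorus (Fin 2) → EuclideanSpace ℝ (Fin 2), IsSmooth v → (∀ n, n ≤ 6 → wordEnergy n v ≤ Lv) →
      ∀ j, HasDecay (latOrder (Fin 2) + 2) M (fun k => mFourierCoeff (fun x => ((v x j : ℝ) : ℂ)) k) := by
    intro v hv hvL j
    rw [hlat]
    exact hasDecay_mFourierCoeff_apply_of_wordEnergy_le hv 6 (hvL 0 (by norm_num)) (hvL 6 le_rfl) j
  have hslice : ∀ {c : ℝ} {u : ℝ → UnitAddTorus (Fin 2) → EuclideanSpace ℝ (Fin 2)} {p : ℝ → UnitAddTorus (Fin 2) → ℝ},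
      a < c → c ≤ b → Torus.IsClassicalNSSolutionOn (Icc a c) ν f u p → u a = u₀ →
        ∀ t ∈ Icc a c, ∀ n, n ≤ 6 → wordEnergy n (u t) ≤ Lv := by
    intro c u p hac hcb h h0 t ht n hn
    have h1 := hB hac (by linarith) h (fun n hn => by rw [h0]; exact hDn n hn)
      (fun n hn s hs => hΦf n hn s ⟨hs.1, hs.2.trans hcb⟩) n hn t ht
    exact h1.trans (le_max_left _ _)
  -- (3) the uniform restart step at level `M`
  obtain ⟨θ, hθ, hrestart⟩ := exists_classicalNS_forced_restart hν hab hū' hūdiv hf' M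
  -- (4) continuation: a solution on `[a, min b (a + b₀ + n θ/2)]` for every `n`
  set b₀ : ℝ := min (b - a) θ with hb₀
  have hb₀0 : 0 < b₀ := lt_min (sub_pos.2 hab) hθ
  have hb₀1 : b₀ ≤ b - a := min_le_left _ _
  have hb₀2 : b₀ ≤ θ := min_le_right _ _
  have key : ∀ n : ℕ, ∃ (u : ℝ → UnitAddTorus (Fin 2) → EuclideanSpace ℝ (Fin 2)) (p : ℝ → UnitAddTorus (Fin 2) → ℝ),
      Torus.IsClassicalNSSolutionOn (Icc a (min b (a + b₀ + n * (θ / 2)))) ν f u p ∧ u a = u₀ := by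
    intro n
    induction n with
    | zero =>
        have e : min b (a + b₀ + ((0 : ℕ) : ℝ) * (θ / 2)) = a + b₀ := by
          rw [Nat.cast_zero, zero_mul, add_zero]
          exact min_eq_right (by linarith)
        obtain ⟨u, p, h, h0⟩ := hrestart a ⟨le_rfl, hab.le⟩ b₀ hb₀0 hb₀2 (by linarith) u₀ hu₀ hu₀div
          (hdec u₀ hu₀ fun n hn => (hDn n hn).trans (le_max_right _ _))
        exact ⟨u, p, by rw [e]; exact h, h0⟩
    | succ n ih =>
        obtain ⟨u, p, h, h0⟩ := ih
        have hnθ : (0 : ℝ) ≤ n * (θ / 2) := by positivity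
        have hac : a < min b (a + b₀ + n * (θ / 2)) := lt_min hab (by linarith)
        have hcb : min b (a + b₀ + n * (θ / 2)) ≤ b := min_le_left _ _
        have hcast : ((n + 1 : ℕ) : ℝ) * (θ / 2) = n * (θ / 2) + θ / 2 := by push_cast; ring
        rcases eq_or_lt_of_le hcb with hcb' | hcb'
        · -- the window already reaches `b`
          have e : min b (a + b₀ + ((n + 1 : ℕ) : ℝ) * (θ / 2)) = b := by
            rw [hcast]
            have hb' : b ≤ a + b₀ + n * (θ / 2) := by
              rcases min_cases b (a + b₀ + n * (θ / 2)) with ⟨h1, h2⟩ | ⟨h1, h2⟩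
              · exact h2
              · linarith
            exact min_eq_left (by linarith)
          refine ⟨u, p, ?_, h0⟩
          rw [e]
          rw [hcb'] at h
          exact h
        · -- restart at `s = max a (c - θ/2)`, `c` the current end
          set c : ℝ := min b (a + b₀ + n * (θ / 2)) with hc
          have hcA : c = a + b₀ + n * (θ / 2) := by
            rcases min_cases b (a + b₀ + n * (θ / 2)) with ⟨h1, _⟩ | ⟨h1, _⟩
            · exact absurd h1 (ne_of_lt hcb')
            · exact h1
          set s : ℝ := max a (c - θ / 2) with hs
          have has : a ≤ s := le_max_left _ _
          have hsc : s < c := max_lt hac (by linarith)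
          have hsb : s ∈ Icc a b := ⟨has, hsc.le.trans hcb⟩
          have hsc2 : c - θ / 2 ≤ s := le_max_right _ _
          set θ' : ℝ := min θ (b - s) with hθ'
          have hθ'0 : 0 < θ' := lt_min hθ (by linarith)
          have hθ'θ : θ' ≤ θ := min_le_left _ _
          have hsθ'b : s + θ' ≤ b := by
            have := min_le_right θ (b - s); linarith
          -- the datum `u s` has level `M`
          have hsIc : s ∈ Icc a c := ⟨has, hsc.le⟩
          have hus : IsSmooth (u s) := h.smooth_velocity.isSmooth_slice hsIc
          have husdiv : IsDivFree (u s) := h.divFree s hsIc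
          have husM := hdec (u s) hus fun m hm => hslice hac hcb h h0 s hsIc m hm
          obtain ⟨u₂, p₂, h₂, h₂0⟩ := hrestart s hsb θ' hθ'0 hθ'θ hsθ'b (u s) hus husdiv husM
          -- glue: `a ≤ s < c ≤ s + θ'`
          have hcsθ : c ≤ s + θ' := by
            rcases min_cases θ (b - s) with ⟨h1, _⟩ | ⟨h1, _⟩
            · rw [hθ', h1]; linarith
            · rw [hθ', h1]; linarith
          obtain ⟨U, P, hUP, hUa, -⟩ := h.glue_restart hν.le h₂ has hsc hcsθ h₂0
          -- the new window `[a, c']`, `c' = min b (c + θ/2) ≤ s + θ'`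
          have hc's : min b (a + b₀ + ((n + 1 : ℕ) : ℝ) * (θ / 2)) ≤ s + θ' := by
            rw [hcast]
            rcases min_cases θ (b - s) with ⟨h1, _⟩ | ⟨h1, _⟩
            · rw [hθ', h1]
              exact (min_le_right _ _).trans (by linarith)
            · rw [hθ', h1]
              exact (min_le_left _ _).trans (by linarith)
          have hac' : a < min b (a + b₀ + ((n + 1 : ℕ) : ℝ) * (θ / 2)) := lt_min hab (by rw [hcast]; linarith)
          exact ⟨U, P, hUP.mono (Icc_subset_Icc le_rfl hc's) (uniqueDiffOn_Icc hac'),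
            by rw [hUa a ⟨le_rfl, has⟩]; exact h0⟩
  -- (5) finitely many steps reach `b`
  obtain ⟨n, hn⟩ := exists_nat_ge ((b - a) / (θ / 2))
  obtain ⟨u, p, h, h0⟩ := key n
  have hle : b - a ≤ n * (θ / 2) := by
    rwa [div_le_iff₀ (by positivity)] at hn
  have e : min b (a + b₀ + n * (θ / 2)) = b := min_eq_left (by linarith)
  rw [e] at h
  exact ⟨u, p, h, h0⟩

/-- **Global classical solutions on `[0, τ] × 𝕋²` from a force in potential form on `[0, τ]`** (the special
case `S = [0, τ]` of `exists_classicalNS_forced_fin_two`). [cite: Ladyzhenskaya1959, Thm. 1] -/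
theorem exists_classicalNS_forced_fin_two_Icc {ν τ : ℝ} (hν : 0 < ν) (hτ : 0 < τ)
    {ū f : ℝ → UnitAddTorus (Fin 2) → EuclideanSpace ℝ (Fin 2)}
    (hū : Torus.IsSmoothSpaceTimeOn (Icc 0 τ) ū) (hūdiv : ∀ t ∈ Icc 0 τ, IsDivFree (ū t))
    (hf : ∀ t ∈ Icc 0 τ, ∀ x, Torus.timeDerivWithin (Icc 0 τ) ū t x = f t x)
    {u₀ : UnitAddTorus (Fin 2) → EuclideanSpace ℝ (Fin 2)} (hu₀ : IsSmooth u₀) (hu₀div : IsDivFree u₀) :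
    ∃ (u : ℝ → UnitAddTorus (Fin 2) → EuclideanSpace ℝ (Fin 2)) (p : ℝ → UnitAddTorus (Fin 2) → ℝ),
      Torus.IsClassicalNSSolutionOn (Icc 0 τ) ν f u p ∧ u 0 = u₀ :=
  exists_classicalNS_forced_fin_two hν hτ subset_rfl hū hūdiv hf hu₀ hu₀div

end Global

end Torus

end Literature.Analysis.FluidPDE

end
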